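import Literature.AlgebraicGeometry.Motives.LinesGenerateChowOneLinear
import HarnessLib

/-!
# Cellular peeling of one-cycles, and `CH₁` of an arbitrary linear subspace

Two reusable steps of the cellular method (Fulton, *Intersection Theory*, Example 1.9.1) behind
`CH₁(ℙⁿ) = ℤ · [line]` (`Motives/ChowProjectiveSpaceLines`), isolated for the treatment of quadric
hypersurfaces:

* `exists_isRationallyEquivalent_sum_map_of_cell` — **peeling a cell**: on an integral compact
  `k`-scheme `Y` of finite type, if an open `U` has `A₁(U) = 0` and its complement is covered by
  the closures of finitely many points `y₁, …, y_r`, then every `1`-cycle on `Y` is rationally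
  equivalent on `Y` to a sum of push-forwards of `1`-cycles of the integral closed subschemes
  `closure {yₐ}` (the localisation sequence, Fulton Prop. 1.8, and the decomposition of a cycle
  supported on `⋃ closure {yₐ}`); `IsRationallyEquivalent.map_closedSubvariety` pushes rational
  equivalences forward along `closure {y} ↪ Y` (Fulton Thm. 1.4, the tree's
  `map_mem_ratTrivial_holds`);
* `exists_linearSubst'` — an invertible linear substitution sending the last `t` variables to
  `t` given independent linear forms (`exists_basis_extending` in the shape `Fin (N + 1)`, `t ≤ N`);
* `exists_isRationallyEquivalent_zsmul_of_range_eq_zeroLocus_linear` — **`CH₁` of a linear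
  subspace**: for an integral `Y` closed-immersed onto `V₊(L₁, …, L_t) ⊆ ℙᴺ` (`t < N`, independent
  linear forms), every `1`-cycle on `Y` is rationally equivalent on `Y` to `a • [y]` for a point
  `y` whose image closure is a line `V₊(L'₁, …, L'_{N-1})` (transport of the coordinate case
  `Motives/ChowProjectiveSpaceLines` by a projective linear transformation, as in
  `Motives/LinesGenerateChowOneLinear`).

* cells in general: `exists_iso_preimage_basicOpen_of_preimage_eq` (a reduced closed subscheme of
  `Proj` whose trace on the chart `D₊(xᵢ) ≅ 𝔸ⁿ` is the image of a closed immersion from a reduced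
  scheme is, over `D₊(xᵢ)`, isomorphic to its source) and `chartι_preimage_zeroLocus_of_mem`
  (`chartι⁻¹ V₊(G) = V(G dehomogenised)` for forms of positive degree).

Everything is proved; no named facts.

## References

* W. Fulton, *Intersection Theory*, Example 1.9.1, Prop. 1.8, Thm. 1.4. [Fulton1998]
* R. Hartshorne, *Algebraic Geometry*, II Prop. 2.5, II Example 7.1.1. [Hartshorne1977]
-/

noncomputable section

open CategoryTheory AlgebraicGeometry Order TopologicalSpace

universe u

namespace Literature.AlgebraicGeometry.Motives

namespace ProjectiveSpaceCells

/-! ### Cells in general: reduced closed subschemes of `Proj` with prescribed trace on a chart -/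

section Cells

open _root_.MvPolynomial

variable (k : Type u) [Field k] {n : ℕ}

attribute [local instance] MvPolynomial.gradedAlgebra ProjBaseChange.algebraBase

local notation "𝓐" => MvPolynomial.homogeneousSubmodule (Fin (n + 1)) k

/-- If the trace of `S ⊆ ℙⁿ` on the chart `D₊(xᵢ) ≅ 𝔸ⁿ` is the image of `g : Z ⟶ 𝔸ⁿ`, the points
of the open subscheme `D₊(xᵢ)` lying on `S` are the image of `g ≫ (𝔸ⁿ ≅ D₊(xᵢ))`. [folklore] -/
theorem range_comp_chartIsoBasicOpen {Z : Scheme.{u}}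
    (g : Z ⟶ Spec (CommRingCat.of (MvPolynomial (Fin n) k))) (i : Fin (n + 1)) {S : Set ↥(Proj 𝓐)}
    (hS : (chartι k n i).base ⁻¹' S = Set.range g.base) :
    Set.range (g ≫ (chartIsoBasicOpen k i).hom).base =
      (Proj.basicOpen 𝓐 (MvPolynomial.X i)).ι.base ⁻¹' S := by
  ext u
  simp only [Set.mem_range, Set.mem_preimage, Scheme.Hom.comp_apply]
  constructor
  · rintro ⟨p, rfl⟩
    rw [Scheme.Opens.ι_apply, chartIsoBasicOpen_hom_apply, ← Set.mem_preimage, hS]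
    exact ⟨p, rfl⟩
  · intro hu
    obtain ⟨p, hp⟩ := (chartIsoBasicOpen k i).hom.homeomorph.surjective u
    change (chartIsoBasicOpen k i).hom p = u at hp
    rw [Scheme.Opens.ι_apply, ← hp, chartIsoBasicOpen_hom_apply, ← Set.mem_preimage, hS] at hu
    obtain ⟨q, hq⟩ := hu
    exact ⟨q, by rw [hq, hp]⟩

/-- **Cells of reduced closed subschemes of `ℙⁿ`.** Let `e : Y ↪ ℙⁿ_k` be a closed immersion from
a reduced scheme with image `S`, and `g : Z ↪ 𝔸ⁿ` a closed immersion from a reduced scheme whose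
image is the trace of `S` on the `i`-th chart. Then the open part of `Y` over `D₊(xᵢ)` is
isomorphic to `Z` (uniqueness of the reduced closed subscheme structure,
`Motives/ReducedClosedSubschemeIso`). [cite: Fulton1998, Example 1.9.1] -/
theorem exists_iso_preimage_basicOpen_of_preimage_eq {Y Z : Scheme.{u}} [IsReduced Y] [IsReduced Z]
    (e : Y ⟶ Proj 𝓐) [IsClosedImmersion e]
    (g : Z ⟶ Spec (CommRingCat.of (MvPolynomial (Fin n) k))) [IsClosedImmersion g] (i : Fin (n + 1))
    (hS : (chartι k n i).base ⁻¹' Set.range e.base = Set.range g.base) :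
    Nonempty (↑(e ⁻¹ᵁ Proj.basicOpen 𝓐 (MvPolynomial.X i)) ≅ Z) := by
  obtain ⟨ε, -⟩ := exists_iso_of_isClosedImmersion_of_range_eq
    (g ≫ (chartIsoBasicOpen k i).hom) (e ∣_ Proj.basicOpen 𝓐 (MvPolynomial.X i))
    (by rw [range_comp_chartIsoBasicOpen k g i hS, range_morphismRestrict])
  exact ⟨ε⟩

/-- **`D₊(xᵢ) ∩ V₊(G)` in the chart** for a form `G` of positive degree: the preimage of `V₊(G)`
under the `i`-th chart is `V(G(y)) ⊆ Spec k[y]`, `G(y)` the dehomogenisation of `G` at `xᵢ`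
(the tree's `ProjSubscheme.awayι_preimage_zeroLocus` through `chartAlgEquiv`). [folklore] -/
theorem chartι_preimage_zeroLocus_of_mem (i : Fin (n + 1)) {d : ℕ} (hd : 0 < d)
    {G : MvPolynomial (Fin (n + 1)) k} (hG : G ∈ 𝓐 d) :
    (chartι k n i).base ⁻¹' ProjectiveSpectrum.zeroLocus 𝓐 {G} =
      PrimeSpectrum.zeroLocus {ProjectiveSpace.dehomogenize k i G} := by
  rw [chartι, Scheme.Hom.comp_base, TopCat.coe_comp, Set.preimage_comp,
    ProjSubscheme.awayι_preimage_zeroLocus 𝓐 (ProjectiveSpace.X_mem i) zero_lt_one hG hd]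
  change PrimeSpectrum.comap (ProjectiveSpace.chartAlgEquiv k i).toRingEquiv.toRingHom ⁻¹' _ = _
  rw [PrimeSpectrum.preimage_comap_zeroLocus, Set.image_singleton]
  congr 2
  change ProjectiveSpace.ofChartRingHom k i
    (HomogeneousLocalization.Away.mk 𝓐 (ProjectiveSpace.X_mem i) d _ _) = _
  rw [ProjectiveSpace.ofChartRingHom_mk, pow_one]

end Cells

/-! ### Push-forward of rational equivalence along `closure {y} ↪ Y` -/

section Pushforward

variable {k : Type u} [Field k]

/-- Push-forward along a closed immersion as an additive map. [folklore] -/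
def mapAddHom {W X : Scheme.{u}} (ι : W ⟶ X) [IsClosedImmersion ι] :
    AlgebraicCycle W ℤ →+ AlgebraicCycle X ℤ :=
  AddMonoidHom.mk' (AlgebraicCycle.map ι height height) (algebraicCycleMap_add ι height height)

/-- `mapAddHom ι c = ι_* c` (`rfl`). [folklore] -/
@[simp] theorem mapAddHom_apply {W X : Scheme.{u}} (ι : W ⟶ X) [IsClosedImmersion ι]
    (c : AlgebraicCycle W ℤ) : mapAddHom ι c = AlgebraicCycle.map ι height height c := rfl

/-- **Proper push-forward of rational equivalence along a closed immersion over `k`** (Fulton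
Thm. 1.4, the tree's `map_mem_ratTrivial_holds`): for a closed immersion `ι : W ↪ Y` of schemes of
finite type over `k`, rationally equivalent cycles on `W` have rationally equivalent images.
[cite: Fulton1998, Thm. 1.4] -/
theorem IsRationallyEquivalent.map_of_isClosedImmersion {W Y : Scheme.{u}} (ι : W ⟶ Y)
    [IsClosedImmersion ι] (f : Y ⟶ Spec (CommRingCat.of k)) [LocallyOfFiniteType f] {d : ℕ}
    {c c' : AlgebraicCycle W ℤ} (h : IsRationallyEquivalent c c' d) :
    IsRationallyEquivalent (AlgebraicCycle.map ι height height c)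
      (AlgebraicCycle.map ι height height c') d := by
  let YO : SchemeOver k := Over.mk f
  let WO : SchemeOver k := Over.mk (ι ≫ f)
  let ιO : WO ⟶ YO := Over.homMk ι rfl
  haveI : LocallyOfFiniteType YO.hom := ‹LocallyOfFiniteType f›
  haveI : LocallyOfFiniteType WO.hom := inferInstanceAs (LocallyOfFiniteType (ι ≫ f))
  haveI : IsProper ιO.left := inferInstanceAs (IsProper ι)
  have hpush := map_mem_ratTrivial_holds d ιO h
  change mapAddHom ι (c - c') ∈ ratTrivial Y d at hpush
  rw [map_sub] at hpush
  exact hpush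

end Pushforward

/-! ### Peeling a cell -/

section Peeling

variable {k : Type u} [Field k]

/-- Evaluation of a finite combination of prime cycles. [folklore] -/
theorem sum_smul_primeCycle_apply {Y : Scheme.{u}} (T : Finset Y) (g : Y → ℤ) (w : Y)
    [Decidable (w ∈ T)] :
    (∑ z ∈ T, g z • primeCycle z) w = if w ∈ T then g w else 0 := by
  classical
  simp only [Function.locallyFinsuppWithin.coe_sum, Finset.sum_apply,
    Function.locallyFinsuppWithin.coe_zsmul, Pi.smul_apply, smul_eq_mul]
  by_cases hw : w ∈ T
  · rw [if_pos hw, Finset.sum_eq_single w (fun z _ hzw ↦ by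
      rw [primeCycle_apply_of_ne (Ne.symm hzw), mul_zero]) (fun h ↦ absurd hw h),
      primeCycle_apply_self, mul_one]
  · rw [if_neg hw]
    refine Finset.sum_eq_zero fun z hz ↦ ?_
    have hzw : w ≠ z := fun h ↦ hw (h ▸ hz)
    rw [primeCycle_apply_of_ne hzw, mul_zero]

/-- **Peeling a cell** (Fulton Example 1.9.1, one step). Let `Y` be an integral compact scheme of
finite type over `k`, `U ⊆ Y` an open subscheme with `A₁(U) = 0`, and `y₁, …, y_r` points of `Y`
whose closures cover `Y ∖ U`. Then every `1`-cycle `c` on `Y` is rationally equivalent on `Y` to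
`Σₐ (ιₐ)_* cₐ` for `1`-cycles `cₐ` on the integral closed subschemes `closure {yₐ} ↪ Y`.
[cite: Fulton1998, Example 1.9.1 and Prop. 1.8] -/
theorem exists_isRationallyEquivalent_sum_map_of_cell {Y : Scheme.{u}} [IsIntegral Y]
    [CompactSpace ↥Y] (f : Y ⟶ Spec (CommRingCat.of k)) [LocallyOfFiniteType f] [QuasiCompact f]
    (U : Y.Opens) (hU : cyclesOfDim (U : Scheme.{u}) 1 ≤ ratTrivial (U : Scheme.{u}) 1)
    {r : ℕ} (y : Fin r → Y) (hcover : ∀ z : Y, z ∉ U → ∃ a, z ∈ closure {y a})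
    (c : AlgebraicCycle Y ℤ) (hc : c ∈ cyclesOfDim Y 1) :
    ∃ cs : (a : Fin r) → AlgebraicCycle (ClosedSubvariety.ofPoint Y (y a)).carrier ℤ,
      (∀ a, cs a ∈ cyclesOfDim (ClosedSubvariety.ofPoint Y (y a)).carrier 1) ∧
        IsRationallyEquivalent c
          (∑ a, AlgebraicCycle.map (ClosedSubvariety.ofPoint Y (y a)).ι height height (cs a)) 1 := by
  classical
  let YO : SchemeOver k := Over.mk f
  haveI : LocallyOfFiniteType YO.hom := ‹LocallyOfFiniteType f›
  haveI : QuasiCompact YO.hom := ‹QuasiCompact f›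
  -- localisation sequence
  have hres : flatPullback U.ι locallyFinsupp_flatPullbackFun_holds c ∈
      ratTrivial (U : Scheme.{u}) 1 := by
    refine hU (fun u hu ↦ ?_)
    rw [flatPullback_ι_apply] at hu
    calc height u = height (U.ι.base u) := (height_opens_ι_base YO U u).symm
      _ = _ := hc _ hu
  obtain ⟨c', hc', hsupp, hcc'⟩ : ∃ c' ∈ cyclesOfDim Y 1, (∀ z : Y, c' z ≠ 0 → z ∉ U) ∧
      IsRationallyEquivalent c c' 1 :=
    Fulton1998_localizationSequence_holds YO U locallyFinsupp_flatPullbackFun_holds 1 c hc hres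
  by_cases hr : r = 0
  · subst hr
    refine ⟨fun a ↦ a.elim0, fun a ↦ a.elim0, ?_⟩
    have hc'0 : c' = 0 := by
      ext z
      by_contra h
      obtain ⟨a, -⟩ := hcover z (hsupp z h)
      exact a.elim0
    rw [hc'0] at hcc'
    simpa using hcc'
  haveI : NeZero r := ⟨hr⟩
  -- assign each support point to a closure containing it
  let a : Y → Fin r := fun z ↦ if h : c' z ≠ 0 then (hcover z (hsupp z h)).choose else 0
  have ha : ∀ z, c' z ≠ 0 → z ∈ closure {y (a z)} := fun z h ↦ by
    simp only [a, dif_pos h]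
    exact (hcover z (hsupp z h)).choose_spec
  let S : Finset Y := (finite_support_of_compactSpace c').toFinset
  have hS : Function.support c' ⊆ (S : Set Y) := fun z hz ↦ by simpa [S] using hz
  let cY : Fin r → AlgebraicCycle Y ℤ := fun b ↦ ∑ z ∈ S.filter (fun z ↦ a z = b), c' z • primeCycle z
  have hcY : ∀ b w, cY b w = if w ∈ S.filter (fun z ↦ a z = b) then c' w else 0 := fun b w ↦
    sum_smul_primeCycle_apply _ _ w
  have hcY_ne : ∀ b w, cY b w ≠ 0 → a w = b ∧ c' w ≠ 0 := fun b w h ↦ by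
    rw [hcY] at h
    split_ifs at h with hw
    · exact ⟨(Finset.mem_filter.mp hw).2, h⟩
    · exact absurd rfl h
  -- the pieces, viewed on the closed subvarieties `closure {y b}`
  let Yb := fun b ↦ ClosedSubvariety.ofPoint Y (y b)
  have hvan : ∀ b, ∀ w ∉ Set.range (Yb b).ι.base, cY b w = 0 := fun b w hw ↦ by
    by_contra h
    obtain ⟨hab, hc'w⟩ := hcY_ne b w h
    apply hw
    rw [ClosedSubvariety.range_ofPoint_ι, ← hab]
    exact ha w hc'w
  refine ⟨fun b ↦ algebraicCycleComap (Yb b).ι (Yb b).ι.isClosedEmbedding.injective (cY b),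
    fun b ↦ algebraicCycleComap_mem_cyclesOfDim (Yb b).ι (fun w hw ↦ hc' w (hcY_ne b w hw).2), ?_⟩
  have hsum : ∑ b, AlgebraicCycle.map (Yb b).ι height height
      (algebraicCycleComap (Yb b).ι (Yb b).ι.isClosedEmbedding.injective (cY b)) = c' := by
    simp only [algebraicCycleMap_comap _ _ (hvan _), cY]
    rw [Finset.sum_fiberwise S a (fun z ↦ c' z • primeCycle z)]
    exact (eq_sum_smul_primeCycle_of_support_subset c' hS).symm
  rw [hsum]
  exact hcc'

end Peeling

/-! ### `CH₁` of an arbitrary linear subspace -/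

section Linear

open _root_.MvPolynomial

variable {k : Type u} [Field k] {N : ℕ}

attribute [local instance] MvPolynomial.gradedAlgebra ProjBaseChange.algebraBase

local notation "𝓐" => MvPolynomial.homogeneousSubmodule (Fin (N + 1)) k

/-- **An invertible linear substitution sending the last `t` variables to given independent linear
forms** (`t ≤ N`; the shape-`Fin (N + 1)` version of `exists_linearSubst`). [folklore] -/
theorem exists_linearSubst' {t : ℕ} (ht : t ≤ N) (L : Fin t → MvPolynomial (Fin (N + 1)) k)
    (hL : ∀ a, (L a).IsHomogeneous 1) (hli : LinearIndependent k L) :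
    ∃ τ τ' : Fin (N + 1) → MvPolynomial (Fin (N + 1)) k,
      (∀ j, (τ j).IsHomogeneous 1) ∧ (∀ j, (τ' j).IsHomogeneous 1) ∧
        (∀ p, MvPolynomial.aeval τ (MvPolynomial.aeval τ' p) = p) ∧
          (∀ p, MvPolynomial.aeval τ' (MvPolynomial.aeval τ p) = p) ∧
          (∀ a : Fin t, τ ⟨N - t + 1 + a, by omega⟩ = L a) ∧ LinearIndependent k τ := by
  classical
  let w : Fin t → (Fin (N + 1) → k) := fun a j ↦ MvPolynomial.coeff (Finsupp.single j 1) (L a)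
  have hwL : ∀ a, lin (w a) = L a := fun a ↦ (eq_lin_of_isHomogeneous_one (hL a)).symm
  have hw : LinearIndependent k w := by
    refine LinearIndependent.of_comp linMap ?_
    have : ⇑linMap ∘ w = L := _root_.funext fun a ↦ hwL a
    rw [this]; exact hli
  obtain ⟨b, hb⟩ := exists_basis_extending w hw (m := N - t + 1) (by omega)
  obtain ⟨τ', hτ, hτ', hinv, hinv', hτli⟩ := exists_linearSubst_of_basis b
  refine ⟨fun j ↦ lin (b j), τ', hτ, hτ', hinv, hinv', fun a ↦ ?_, hτli⟩
  change lin (b ⟨N - t + 1 + a, _⟩) = L a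
  rw [hb a, hwL a]

/-- **`CH₁` of a linear subspace is generated by a line, for any integral model.** Let
`e : Y ↪ ℙᴺ_k` be a closed immersion from an integral scheme onto the linear subspace
`V₊(L₁, …, L_t)` cut out by `t < N` independent linear forms. Then every `1`-cycle on `Y` is
rationally equivalent on `Y` to `a • [y]` for a point `y` of dimension `1` whose image closure is
a line `V₊(L'₁, …, L'_{N-1})` (coordinate case `Motives/ChowProjectiveSpaceLines` transported by
a projective linear transformation, Hartshorne II 7.1.1). [cite: Fulton1998, Example 1.9.3]
[cite: Hartshorne1977, II Example 7.1.1] -/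
theorem exists_isRationallyEquivalent_zsmul_of_range_eq_zeroLocus_linear {t : ℕ} (htN : t < N)
    (L : Fin t → MvPolynomial (Fin (N + 1)) k) (hli : LinearIndependent k L)
    (hL : ∀ a, (L a).IsHomogeneous 1) {Y : Scheme.{u}} [IsIntegral Y] (e : Y ⟶ Proj 𝓐)
    [IsClosedImmersion e]
    (hrange : Set.range e.base = ProjectiveSpectrum.zeroLocus 𝓐 (Set.range L))
    (c : AlgebraicCycle Y ℤ) (hc : c ∈ cyclesOfDim Y 1) :
    ∃ (y : Y) (a : ℤ) (L' : Fin (N - 1) → MvPolynomial (Fin (N + 1)) k),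
      LinearIndependent k L' ∧ (∀ j, (L' j).IsHomogeneous 1) ∧
        ⇑e.base '' closure {y} = ProjectiveSpectrum.zeroLocus 𝓐 (Set.range L') ∧
          height y = 1 ∧ IsRationallyEquivalent c (a • primeCycle y) 1 := by
  classical
  obtain ⟨τ, τ', hτ, hτ', hinv, hinv', hτL, hτli⟩ := exists_linearSubst' htN.le L hL hli
  let σ := ProjectiveSpace.substMapHom τ hτ τ' hτ' hinv
  haveI : IsIso σ := isIso_substMapHom τ hτ τ' hτ' hinv hinv'
  let e₂ := e ≫ σ
  -- `σ⁻¹ Λ_{N-t} = V₊(L) = e(Y)`, so `e₂(Y) = Λ_{N-t}`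
  have hpre : σ.base ⁻¹' coordSubspace k N (N - t) = Set.range e.base := by
    change σ.base ⁻¹' ProjectiveSpectrum.zeroLocus _ _ = _
    rw [substMapHom_preimage_zeroLocus, hrange]
    congr 1
    ext f
    simp only [Set.mem_image, Set.mem_setOf_eq, Set.mem_range, exists_exists_and_eq_and,
      MvPolynomial.aeval_X]
    constructor
    · rintro ⟨j, hj, rfl⟩
      refine ⟨⟨j - (N - t + 1), by omega⟩, ?_⟩
      rw [← hτL]
      congr 1
      exact Fin.ext (by simp; omega)
    · rintro ⟨a, rfl⟩
      exact ⟨⟨N - t + 1 + a, by omega⟩, by simp; omega, hτL a⟩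
  have hrange₂ : Set.range e₂.base = coordSubspace k N (N - t - 1 + 1) := by
    rw [show N - t - 1 + 1 = N - t by omega, Scheme.Hom.comp_base, TopCat.coe_comp, Set.range_comp,
      ← hpre]
    exact Set.image_preimage_eq _ σ.homeomorph.surjective
  obtain ⟨y, a, hy, hrat⟩ := exists_isRationallyEquivalent_zsmul_of_range_eq_coordSubspace k 1
    (N - t - 1) (by omega) e₂ hrange₂ c hc
  have hidx : ∀ j : Fin (N - 1), 1 + 1 + (j : ℕ) < N + 1 := fun j ↦ by omega
  have hL' : (fun j ↦ MvPolynomial.aeval τ (coordForms k N 1 j)) =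
      τ ∘ fun j : Fin (N - 1) ↦ (⟨1 + 1 + (j : ℕ), hidx j⟩ : Fin (N + 1)) := by
    funext j
    simp [coordForms]
  refine ⟨y, a, fun j ↦ MvPolynomial.aeval τ (coordForms k N 1 j), ?_, fun j ↦ ?_, ?_, ?_, hrat⟩
  · rw [hL']
    exact hτli.comp _ fun a b hab ↦ Fin.ext (by simpa using congrArg Fin.val hab)
  · exact (isHomogeneous_coordForms k N 1 j).aeval τ hτ
  · have himg : ⇑e.base '' closure {y} = σ.base ⁻¹' (e₂.base '' closure {y}) := by
      rw [Scheme.Hom.comp_base, TopCat.coe_comp, Set.image_comp]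
      exact (Set.preimage_image_eq _ σ.isClosedEmbedding.injective).symm
    rw [himg, ← e₂.isClosedEmbedding.closure_image_eq, Set.image_singleton, hy,
      closure_coordGenericPoint]
    change σ.base ⁻¹' ProjectiveSpectrum.zeroLocus _ _ = _
    rw [substMapHom_preimage_zeroLocus]
    congr 1
    rw [← range_coordForms, ← Set.range_comp]
    rfl
  · rw [← height_base_eq_of_isClosedImmersion' e₂ y, hy]
    simpa using height_coordGenericPoint k (n := N) (m := 1) (by omega)

end Linear

end ProjectiveSpaceCells

end Literature.AlgebraicGeometry.Motives
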